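import Summits.BirchSwinnertonDyer.BirchSwinnertonDyer.Theorems.ManinLocalTwoThreeThreeTorsionIsogenyAscent
import HarnessLib

/-!
# The kernel–lattice dictionary of a `3`-isogeny through a rational `3`-torsion point, and E-an-100₉ ⟺ NB₃^V

Summit `BirchSwinnertonDyer`, route `ManinLocalTwoThree` (cell bsd-f2-manin), crux C3 `ManinPrimeToThreeAtNine`
(stmt-BirchSwinnertonDyer-22968), line `kato_shift_three` v14 (stub NB₃^V `NoAscendingThreeTorsionOptimal`).  Sequel of
`Theorems/ManinLocalTwoThreeThreeTorsionIsogenyAscent.lean` (p648978: (VÉLU₃♯) by name, NB₃^V ⟸ E-an-100₉).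

* §1 `exists_multiplier_of_isogeny_of_threeTorsion_mem_ker` — **THE DICTIONARY, for ANY isogeny**: `W/ℚ` elliptic with a
  datum `D` (Néron pair `Λ`, uniformisation), `T = (X₁, Y₁)` of order `3` on `E♮` with geometric point `P₀ ∈ W(ℚ̄)`,
  `φ : W → W₂` ANY isogeny of degree `3` with `φ(P₀) = 0`, `L₂` a Néron pair of `W₂`: the analytic multiplier `k ∈ ℚ` of `φ`
  (`φ_ℂ(u z) = u₂(kz)`, Silverman VI.4.1(b) + the tree's Galois argument) satisfies `kΛ ⊆ Λ₂`, `3Λ₂ ⊆ kΛ`,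
  **`k⁴c₄(W₂) = A`, `k⁶c₆(W₂) = B`** (`(A, B)` the `u = 1` Vélu pair of `T`) and **`|k|²·covol Λ = 3·covol Λ₂`** — because
  `Λ₂ = k(Λ + ℤz_T)` (third-period `z_T` uniformising `±P₀`; index sandwich `kΛ ⊊ k(Λ + ℤz_T) ⊆ Λ₂`, `[Λ₂ : kΛ] = deg φ = 3`;
  Vélu's lattice `Λ + ℤz_T` has invariants `(A, B)/(12, 216)`, `lattice_eq_of_velu_three_invariants`).  (The proof of p648978
  is this dictionary applied to the quotient isogeny; here it is stated for an arbitrary `φ`.)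
* §2 `noConstantKernelAscendingAtNine_of_noAscendingThreeTorsionOptimal` — **E-an-100₉ ⟸ NB₃^V**: an ascending
  constant-kernel `3`-edge out of an optimal `W` at `9 ∣ N` has a rational kernel point (Galois descent
  `fixedPoints_eq_range_map_holds`) of order `3`, not `2`-torsion, so `Ψ₃(x) = 0` (`three_smul_some_eq_zero_iff`); its
  `E♮`-avatar is a rational `3`-torsion `T`, and §1 with `covol Λ₂ = 3·covol Λ` gives `k² = 9`, i.e. `W₂` carries
  `(3⁻⁴A, 3⁻⁶B)` — forbidden by NB₃^V.  With p648978's converse: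
  **`noConstantKernelAscendingAtNine_iff_noAscendingThreeTorsionOptimal` — an's Stevens-ledger row E-an-100₉ and the lead's
  stub NB₃^V are EQUIVALENT** (so refuter-1's placement of E-an-100₉ under Stevens' Conjecture II, §R66 Prop. 4, and the an
  census 0 / 11 789 apply to the stub verbatim).

HONEST FRAMING: a dictionary and an equivalence of two OPEN `c`-free laws; C3, Manin's conjecture and BSD are NOT proved.
No definitions, no named facts, no sorry.

References: [SilvermanAEC2009] III.4.12, Thm. VI.4.1(b), VIII.§1; J. Vélu, C. R. Acad. Sci. Paris 273 (1971);
[Vatsal2005] Conj. 1.9 (shape of the Stevens ledger).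
-/

set_option linter.dupNamespace false
set_option autoImplicit false

noncomputable section

open scoped Classical

open WeierstrassCurve IsDedekindDomain NumberField Rat.HeightOneSpectrum Polynomial
  Literature.NumberTheory.DiophantineGeometry Literature.NumberTheory.EllipticCurves
  Literature.NumberTheory.EllipticCurves.ModularForms
  Summit.BirchSwinnertonDyer.Rank1Residual.ManinAdditive
  Summit.BirchSwinnertonDyer.Rank1Residual.ManinAdditive.CuspidalKummer
  Summit.BirchSwinnertonDyer.Rank1Residual.ManinAdditive.CuspidalKummerThree
  Summit.BirchSwinnertonDyer.Rank1Residual.ManinAdditive.ThreeIsogenyKernel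

namespace Summit.BirchSwinnertonDyer.BirchSwinnertonDyer.Theorems.ManinLocalTwoThree

/-! ### §1. The kernel–lattice dictionary of a degree-`3` isogeny killing a rational `3`-torsion point -/

/-- **Kernel ↔ lattice for a `3`-isogeny through a rational `3`-torsion point.**  `W/ℚ` elliptic with a datum `D` (Néron pair
`Λ = D.L`, uniformisation `u`), `T = (X₁, Y₁)` of order `3` on `E♮` with geometric point `P₀ ∈ W(ℚ̄)` (coordinates
`(X₁ − b₂/12, Y₁ − (a₁x + a₃)/2)`), `φ : W → W₂` an isogeny of degree `3` with `φ(P₀) = 0`, `L₂` a Néron pair of `W₂`.  Then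
the analytic multiplier `k ∈ ℚ` of `φ` (`φ_ℂ(u z) = u₂(kz)`) satisfies: `kΛ ⊆ Λ₂`, `3Λ₂ ⊆ kΛ` (precisely `∀ z ∈ Λ₂, 3z ∈ kΛ`),
`k⁴c₄(W₂) = A`, `k⁶c₆(W₂) = B` for the `u = 1` Vélu pair `(A, B) = (1440X₁² − 9c₄, 60480X₁³ − 756c₄X₁ − 27c₆)` of `T`, and
`|k|²·covol Λ = 3·covol Λ₂` — because `Λ₂ = k(Λ + ℤz_T)` (third-period `z_T`, `℘(z_T) = X₁`; index sandwich
`kΛ ⊊ k(Λ + ℤz_T) ⊆ Λ₂`, `[Λ₂ : kΛ] = deg φ = 3`; Vélu's lattice `Λ + ℤz_T` has invariants `(A, B)`).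
[cite: SilvermanAEC2009, III.4.12 and Thm. VI.4.1(b)] -/
theorem exists_multiplier_of_isogeny_of_threeTorsion_mem_ker (W : WeierstrassCurve ℚ) [W.IsElliptic] {N : ℕ} [NeZero N]
    (D : ModularParametrizationData W N) {X₁ Y₁ : ℚ} (hT : IsShortThreeTorsion W 1 X₁ Y₁)
    {hns : (W.baseChange (AlgebraicClosure ℚ)).toAffine.Nonsingular
        (algebraMap ℚ (AlgebraicClosure ℚ) (X₁ - W.b₂ / 12))
        (algebraMap ℚ (AlgebraicClosure ℚ) (Y₁ - (W.a₁ * (X₁ - W.b₂ / 12) + W.a₃) / 2))}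
    {P₀ : W.geomPoints} (hP₀ : P₀ = Affine.Point.some _ _ hns)
    {W₂ : WeierstrassCurve ℚ} [W₂.IsElliptic] (φ : Isogeny W W₂) (hdeg : φ.degree = 3) (hP₀ker : φ P₀ = 0)
    {L₂ : PeriodPair} (hL₂ : IsNeronLatticeOf (W₂.baseChange ℂ) L₂) :
    ∃ k : ℚ, k ≠ 0 ∧ (∀ y ∈ D.L.lattice, ((k : ℚ) : ℂ) * y ∈ L₂.lattice) ∧
      (∀ z ∈ L₂.lattice, ∃ y ∈ D.L.lattice, ((3 : ℤ) : ℂ) * z = ((k : ℚ) : ℂ) * y) ∧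
      k ^ 4 * W₂.c₄ = 1440 * X₁ ^ 2 - 9 * W.c₄ ∧
      k ^ 6 * W₂.c₆ = 60480 * X₁ ^ 3 - 756 * W.c₄ * X₁ - 27 * W.c₆ ∧
      ‖((k : ℚ) : ℂ)‖ ^ 2 * ZLattice.covolume D.L.lattice = 3 * ZLattice.covolume L₂.lattice := by
  -- uniformisations and the analytic multiplier `α ∈ ℚ`
  haveI : Algebra.IsAlgebraic ℚ (AlgebraicClosure ℚ) := AlgebraicClosure.isAlgebraic ℚ
  letI : Algebra (AlgebraicClosure ℚ) ℂ := (IsAlgClosed.lift : AlgebraicClosure ℚ →ₐ[ℚ] ℂ).toRingHom.toAlgebra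
  haveI : IsScalarTower ℚ (AlgebraicClosure ℚ) ℂ := IsScalarTower.of_algebraMap_eq' (Subsingleton.elim _ _)
  have hL := D.isNeronLattice
  haveI : (W.baseChange ℂ).IsElliptic := by rw [WeierstrassCurve.baseChange]; infer_instance
  haveI : (W₂.baseChange ℂ).IsElliptic := by rw [WeierstrassCurve.baseChange]; infer_instance
  obtain ⟨u₂, hker₂, -, hu₂⟩ := L₂.exists_addMonoidHom_of_g₂_g₃' hL₂.1 hL₂.2
  obtain ⟨α, hα0, hαΛ, happ, hcard⟩ := φ.exists_mul_baseChange_apply_eq hL.1 hL.2 hL₂.1 hL₂.2 D.uniformize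
    D.ker_uniformize D.uniformize_spec u₂ hker₂ hu₂
  obtain ⟨k, hk⟩ := φ.exists_algebraMap_eq_of_baseChange_apply_eq hL.1 hL.2 hL₂.1 hL₂.2 D.uniformize
    D.ker_uniformize D.uniformize_spec u₂ hker₂ hu₂ happ
  have hkC : (k : ℂ) = α := by rw [← hk, eq_ratCast]
  -- the third-period `z_T` uniformises `±P₀`, so `α z_T ∈ Λ₂`
  have hsm : shortModel W 1 = (⟨0, 0, 0, -W.c₄ / 48, -W.c₆ / 864⟩ : WeierstrassCurve ℚ) := by
    ext <;> simp [shortModel] <;> ring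
  have hq : W.Ψ₃.eval (X₁ - W.b₂ / 12) = 0 := by
    rw [Ψ₃_eval_sub_b₂_div_twelve, ← hsm]
    exact hT.2.eq_zero
  obtain ⟨z₀, hz₀, hx₀, h3z₀⟩ := exists_third_period_of_Ψ₃_root W hL X₁ hq
  have hmemker₂ : ∀ w, u₂ w = 0 ↔ w ∈ L₂.lattice := fun w ↦ by
    rw [← SetLike.mem_coe, ← hker₂]; rfl
  have hbcm := φ.baseChange_map (M := ℂ) P₀
  have hαz₀ : α * z₀ ∈ L₂.lattice := by
    obtain ⟨hz, huz⟩ := D.uniformize_spec z₀ hz₀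
    set ιC := IsScalarTower.toAlgHom ℚ (AlgebraicClosure ℚ) ℂ with hιC
    have hb₂ : (W.baseChange ℂ).b₂ = (W.b₂ : ℂ) := by simp [WeierstrassCurve.baseChange, WeierstrassCurve.map_b₂]
    have hιx : ιC (algebraMap ℚ (AlgebraicClosure ℚ) (X₁ - W.b₂ / 12)) =
        D.L.weierstrassP z₀ - (W.baseChange ℂ).b₂ / 12 := by
      rw [AlgHom.commutes, hx₀, hb₂, eq_ratCast]; push_cast; ring
    have hnsC := (WeierstrassCurve.Affine.baseChange_nonsingular (W := W) (f := ιC) ιC.toRingHom.injective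
      (algebraMap ℚ (AlgebraicClosure ℚ) (X₁ - W.b₂ / 12))
      (algebraMap ℚ (AlgebraicClosure ℚ) (Y₁ - (W.a₁ * (X₁ - W.b₂ / 12) + W.a₃) / 2))).mpr hns
    have hkill : φ.baseChange (Affine.Point.map ιC P₀) = 0 := by
      have h := hbcm
      rw [hP₀ker] at h
      refine h.trans ?_
      exact map_zero _
    have hP₀C : Affine.Point.map ιC P₀ = Affine.Point.some _ _ hnsC := by rw [hP₀]; rfl
    have hkey : φ.baseChange (D.uniformize z₀) = 0 := by
      rcases WeierstrassCurve.Affine.Y_eq_of_X_eq hz.left hnsC.left hιx.symm with h | h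
      · have e : D.uniformize z₀ = Affine.Point.map ιC P₀ := by
          rw [huz, hP₀C]
          simp only [Affine.Point.some.injEq]
          exact ⟨hιx.symm, h⟩
        rw [e, hkill]
      · have e : D.uniformize z₀ = -Affine.Point.map ιC P₀ := by
          rw [huz, hP₀C, Affine.Point.neg_some]
          simp only [Affine.Point.some.injEq]
          exact ⟨hιx.symm, h⟩
        rw [e, map_neg, hkill, neg_zero]
    rw [happ z₀] at hkey
    exact (hmemker₂ _).mp hkey
  -- Vélu's lattice `Λ_V = Λ + ℤz_T` and the sandwich `αΛ ⊊ αΛ_V ⊆ Λ₂`, `[Λ₂ : αΛ] = 3`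
  set A : ℚ := 1440 * X₁ ^ 2 - 9 * W.c₄ with hAdef
  set B : ℚ := 60480 * X₁ ^ 3 - 756 * W.c₄ * X₁ - 27 * W.c₆ with hBdef
  have hne : A ^ 3 ≠ B ^ 2 := by
    have hq' := hq
    rw [Ψ₃_eval_sub_b₂_div_twelve] at hq'
    simp only [WeierstrassCurve.Ψ₃, WeierstrassCurve.b₂, WeierstrassCurve.b₄, WeierstrassCurve.b₆, WeierstrassCurve.b₈,
      eval_add, eval_mul, eval_pow, eval_C, eval_X, eval_ofNat] at hq'
    have hψ : 48 * X₁ ^ 4 - 24 * (W.c₄ / 12) * X₁ ^ 2 - 48 * (W.c₆ / 216) * X₁ - (W.c₄ / 12) ^ 2 = 0 := by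
      linear_combination 16 * hq'
    have hΔ₀ : (W.c₄ / 12) ^ 3 - 27 * (W.c₆ / 216) ^ 2 ≠ 0 := by
      have hΔW : W.Δ ≠ 0 := by rw [← WeierstrassCurve.coe_Δ']; exact W.Δ'.ne_zero
      intro h0; apply hΔW
      linear_combination W.c_relation / 1728 + h0
    have h := velu_three_discr_ne_zero hψ hΔ₀
    intro heq; apply h
    rw [hAdef, hBdef] at heq
    linear_combination heq / 1728
  set V : WeierstrassCurve ℚ := ⟨0, 0, 0, -A / 48, -B / 864⟩ with hV
  have hV4 : V.c₄ = A := by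
    simp only [hV, WeierstrassCurve.c₄, WeierstrassCurve.b₂, WeierstrassCurve.b₄]; ring
  have hV6 : V.c₆ = B := by
    simp only [hV, WeierstrassCurve.c₆, WeierstrassCurve.b₂, WeierstrassCurve.b₄, WeierstrassCurve.b₆]; ring
  have hVΔ : V.Δ = (A ^ 3 - B ^ 2) / 1728 := by
    have h := V.c_relation; rw [hV4, hV6] at h; linear_combination h / 1728
  haveI hVell : V.IsElliptic := ⟨isUnit_iff_ne_zero.mpr (by rw [hVΔ]; exact div_ne_zero (sub_ne_zero.mpr hne) (by norm_num))⟩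
  haveI : (V.baseChange ℂ).IsElliptic := by rw [WeierstrassCurve.baseChange]; infer_instance
  obtain ⟨LV, hLV⟩ := exists_isNeronLatticeOf_holds (V.baseChange ℂ)
  have hc₄W : (W.baseChange ℂ).c₄ = (W.c₄ : ℂ) := by simp [WeierstrassCurve.baseChange, WeierstrassCurve.map_c₄]
  have hc₆W : (W.baseChange ℂ).c₆ = (W.c₆ : ℂ) := by simp [WeierstrassCurve.baseChange, WeierstrassCurve.map_c₆]
  have hc₄V : (V.baseChange ℂ).c₄ = (V.c₄ : ℂ) := by simp [WeierstrassCurve.baseChange, WeierstrassCurve.map_c₄]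
  have hc₆V : (V.baseChange ℂ).c₆ = (V.c₆ : ℂ) := by simp [WeierstrassCurve.baseChange, WeierstrassCurve.map_c₆]
  have h₂ : LV.g₂ = 120 * D.L.weierstrassP z₀ ^ 2 - 9 * D.L.g₂ := by
    rw [hLV.1, hc₄V, hV4, hx₀, hL.1, hc₄W, hAdef]; push_cast; ring
  have h₃ : LV.g₃ = 280 * D.L.weierstrassP z₀ ^ 3 - 42 * D.L.g₂ * D.L.weierstrassP z₀ - 27 * D.L.g₃ := by
    rw [hLV.2, hc₆V, hV6, hx₀, hL.1, hL.2, hc₄W, hc₆W, hBdef]; push_cast; ring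
  obtain ⟨hleV, hz₀V, hidx⟩ := D.L.lattice_eq_of_velu_three_invariants hz₀ h3z₀ LV h₂ h₃
  set M₁ : AddSubgroup ℂ := (D.L.mulLeft α hα0).lattice.toAddSubgroup with hM₁
  set M₂ : AddSubgroup ℂ := (LV.mulLeft α hα0).lattice.toAddSubgroup with hM₂
  set M₃ : AddSubgroup ℂ := L₂.lattice.toAddSubgroup with hM₃
  have h12 : M₁ ≤ M₂ := by
    intro w hw
    rw [hM₁, Submodule.mem_toAddSubgroup, PeriodPair.mem_mulLeft_lattice] at hw
    rw [hM₂, Submodule.mem_toAddSubgroup, PeriodPair.mem_mulLeft_lattice]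
    exact hleV hw
  have h23 : M₂ ≤ M₃ := by
    intro w hw
    rw [hM₂, Submodule.mem_toAddSubgroup, PeriodPair.mem_mulLeft_lattice] at hw
    rw [hM₃, Submodule.mem_toAddSubgroup]
    have ew : w = α * (α⁻¹ * w) := by rw [mul_inv_cancel_left₀ hα0]
    rcases hidx _ hw with h | h | h
    · rw [ew]; exact hαΛ _ h
    · have e : w = α * (α⁻¹ * w - z₀) + α * z₀ := by rw [mul_sub, ← ew]; ring
      rw [e]; exact add_mem (hαΛ _ h) hαz₀
    · have e : w = α * (α⁻¹ * w + z₀) - α * z₀ := by rw [mul_add, ← ew]; ring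
      rw [e]; exact sub_mem (hαΛ _ h) hαz₀
  have h13 : M₁.relIndex M₃ = 3 := by
    rw [hM₁, hM₃, ← hcard, Isogeny.natCard_ker_baseChange_eq_degree, hdeg]
  have hαz₀M₁ : α * z₀ ∉ M₁ := by
    rw [hM₁, Submodule.mem_toAddSubgroup, PeriodPair.mem_mulLeft_lattice, inv_mul_cancel_left₀ hα0]
    exact hz₀
  have hαz₀M₂ : α * z₀ ∈ M₂ := by
    rw [hM₂, Submodule.mem_toAddSubgroup, PeriodPair.mem_mulLeft_lattice, inv_mul_cancel_left₀ hα0]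
    exact hz₀V
  have hM₂₃ : M₂ = M₃ := by
    have hmul := AddSubgroup.relIndex_mul_relIndex M₁ M₂ M₃ h12 h23
    rw [h13] at hmul
    have hne1 : M₁.relIndex M₂ ≠ 1 := by
      rw [Ne, AddSubgroup.relIndex_eq_one]
      exact fun hle ↦ hαz₀M₁ (hle hαz₀M₂)
    have hdvd : M₂.relIndex M₃ ∣ 3 := Dvd.intro_left _ hmul
    rcases (Nat.dvd_prime Nat.prime_three).mp hdvd with h1 | h3
    · exact le_antisymm h23 (AddSubgroup.relIndex_eq_one.mp h1)
    · rw [h3] at hmul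
      exact absurd (by omega : M₁.relIndex M₂ = 1) hne1
  have hΛ₂ : L₂.lattice = (LV.mulLeft α hα0).lattice := by
    apply le_antisymm
    · intro w hw
      have : w ∈ M₃ := by rw [hM₃, Submodule.mem_toAddSubgroup]; exact hw
      rw [← hM₂₃, hM₂, Submodule.mem_toAddSubgroup] at this
      exact this
    · intro w hw
      have : w ∈ M₂ := by rw [hM₂, Submodule.mem_toAddSubgroup]; exact hw
      rw [hM₂₃, hM₃, Submodule.mem_toAddSubgroup] at this
      exact this
  -- invariants of `W₂`
  obtain ⟨e₄, e₆⟩ := IsNeronLatticeOf.c₄_eq_of_lattice_eq_mulLeft hL₂ hα0 hΛ₂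
  rw [hLV.1, hc₄V, hV4] at e₄
  rw [hLV.2, hc₆V, hV6] at e₆
  have h4 : (k : ℚ) ^ 4 * W₂.c₄ = A := by
    have : ((k : ℚ) : ℂ) ^ 4 * (W₂.c₄ : ℂ) = (A : ℂ) := by
      rw [e₄, hkC]; field_simp
    exact_mod_cast this
  have h6 : (k : ℚ) ^ 6 * W₂.c₆ = B := by
    have : ((k : ℚ) : ℂ) ^ 6 * (W₂.c₆ : ℂ) = (B : ℂ) := by
      rw [e₆, hkC]; field_simp
    exact_mod_cast this
  -- `3Λ₂ ⊆ kΛ`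
  have h3mul : ∀ w : ℂ, w ∈ D.L.lattice → 3 * w ∈ D.L.lattice := fun w hw ↦ by
    have e : (3 : ℂ) * w = w + w + w := by ring
    rw [e]; exact add_mem (add_mem hw hw) hw
  have h3v : ∀ v : ℂ, v ∈ LV.lattice → 3 * v ∈ D.L.lattice := fun v hv ↦ by
    rcases hidx v hv with h | h | h
    · exact h3mul v h
    · have e : (3 : ℂ) * v = 3 * (v - z₀) + 3 * z₀ := by ring
      rw [e]; exact add_mem (h3mul _ h) h3z₀
    · have e : (3 : ℂ) * v = 3 * (v + z₀) - 3 * z₀ := by ring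
      rw [e]; exact sub_mem (h3mul _ h) h3z₀
  have hnμ : ∀ z ∈ L₂.lattice, ∃ y ∈ D.L.lattice, ((3 : ℤ) : ℂ) * z = ((k : ℚ) : ℂ) * y := fun z hz ↦ by
    rw [hΛ₂, PeriodPair.mem_mulLeft_lattice] at hz
    refine ⟨3 * (α⁻¹ * z), h3v _ hz, ?_⟩
    rw [hkC]; field_simp; push_cast; ring
  -- covolumes
  have hcovM : ZLattice.covolume (D.L.mulLeft α hα0).lattice / ZLattice.covolume L₂.lattice = 3 := by
    have h := ZLattice.covolume_div_covolume_eq_relIndex' (D.L.mulLeft α hα0).lattice L₂.lattice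
      (fun w hw ↦ by
        have : w ∈ M₁ := by rw [hM₁, Submodule.mem_toAddSubgroup]; exact hw
        have := h23 (h12 this)
        rw [hM₃, Submodule.mem_toAddSubgroup] at this
        exact this)
    rw [h]
    exact_mod_cast h13
  have hk0 : k ≠ 0 := by
    rintro rfl
    apply hα0
    rw [← hkC]; push_cast; rfl
  refine ⟨k, hk0, fun y hy ↦ by rw [hkC]; exact hαΛ y hy, hnμ, h4, h6, ?_⟩
  rw [D.L.covolume_mulLeft_lattice α hα0] at hcovM
  have hpos : 0 < ZLattice.covolume L₂.lattice := ZLattice.covolume_pos L₂.lattice MeasureTheory.volume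
  rw [div_eq_iff hpos.ne'] at hcovM
  rw [hkC]
  linarith

/-! ### §2. The reverse bridge: E-an-100₉ ⟸ NB₃^V, hence E-an-100₉ ⟺ NB₃^V -/

/-- A rational point `(x, y)` of `W` gives the point `(x + b₂/12, y + (a₁x + a₃)/2)` of `E♮ = E_{W,1}`. [folklore] -/
theorem shortModel_equation_of_equation (W : WeierstrassCurve ℚ) {x y : ℚ} (h : W.toAffine.Equation x y) :
    (shortModel W 1).toAffine.Equation (x + W.b₂ / 12) (y + (W.a₁ * x + W.a₃) / 2) := by
  rw [WeierstrassCurve.Affine.equation_iff] at h ⊢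
  have h1 : (shortModel W 1).a₁ = 0 := rfl
  have h2 : (shortModel W 1).a₂ = 0 := rfl
  have h3 : (shortModel W 1).a₃ = 0 := rfl
  have h4 : (shortModel W 1).a₄ = -(W.c₄ / 48) := by simp [shortModel]
  have h6 : (shortModel W 1).a₆ = -(W.c₆ / 864) := by simp [shortModel]
  rw [h1, h2, h3, h4, h6]
  simp only [WeierstrassCurve.c₄, WeierstrassCurve.c₆, WeierstrassCurve.b₂, WeierstrassCurve.b₄, WeierstrassCurve.b₆]
  linear_combination h

/-- **E-an-100₉ ⟸ NB₃^V (the reverse bridge).**  An ascending constant-kernel `3`-edge `φ : W → W₂` out of an optimal `W` at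
`9 ∣ N` has a `ℚ`-rational kernel point `P₀` (Galois descent, `fixedPoints_eq_range_map_holds`) of order `3`; its `E♮`-avatar
`T = (X₁, Y₁)` is a rational `3`-torsion point, and by §1 `k⁴c₄(W₂) = A`, `k⁶c₆(W₂) = B` with `|k|²·covol Λ = 3·covol Λ₂ =
9·covol Λ`, so `k = ±3` and `W₂` carries `(3⁻⁴A, 3⁻⁶B)` — forbidden by NB₃^V. [cite: SilvermanAEC2009, III.4.12 and Thm. VI.4.1(b)] -/
theorem noConstantKernelAscendingAtNine_of_noAscendingThreeTorsionOptimal (hV : NoAscendingThreeTorsionOptimal) :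
    NoConstantKernelAscendingThreeOptimalAtNine := by
  intro W _ _ N _ D hL h9 W₂ _ _ φ L₂ hasc hconst
  obtain ⟨hdeg, -, hL₂, hcov⟩ := hasc
  -- a non-zero kernel point, fixed by `Γ_ℚ`, hence rational
  have hcard : Nat.card φ.toAddMonoidHom.ker = 3 := hdeg
  obtain ⟨P₀, hP₀mem, hP₀ne⟩ : ∃ P₀ ∈ φ.toAddMonoidHom.ker, P₀ ≠ 0 := by
    by_contra h
    push Not at h
    have h1 : Nat.card φ.toAddMonoidHom.ker = 1 := by
      rw [Nat.card_eq_one_iff_exists]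
      exact ⟨⟨0, zero_mem _⟩, fun ⟨x, hx⟩ ↦ Subtype.ext (h x hx)⟩
    omega
  have hP₀ker : φ P₀ = 0 := by simpa using hP₀mem
  have hfix : ∀ σ : Field.absoluteGaloisGroup ℚ, σ • P₀ = P₀ := fun σ ↦ hconst P₀ hP₀mem σ
  have hrange := fixedPoints_eq_range_map_holds W
  have hP₀fix : P₀ ∈ MulAction.fixedPoints (Field.absoluteGaloisGroup ℚ) (geomPoints W) :=
    MulAction.mem_fixedPoints.mpr hfix
  rw [hrange] at hP₀fix
  obtain ⟨Q, hQ⟩ := hP₀fix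
  -- order `3`
  haveI : Fact (Nat.Prime 3) := ⟨Nat.prime_three⟩
  have hord : addOrderOf P₀ = 3 := by
    have hd : addOrderOf P₀ ∣ 3 := hcard ▸ AddSubgroup.addOrderOf_dvd_natCard _ hP₀mem
    rcases (Nat.dvd_prime Nat.prime_three).mp hd with h1 | h3
    · exact absurd (AddMonoid.addOrderOf_eq_one_iff.mp h1) hP₀ne
    · exact h3
  have h3P₀ : (3 : ℤ) • P₀ = 0 := by
    have : (3 : ℕ) • P₀ = 0 := by rw [← hord]; exact addOrderOf_nsmul_eq_zero P₀
    exact_mod_cast this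
  -- the rational coordinates
  rcases Q with _ | ⟨x, y, hxy⟩
  · exact absurd (by rw [← hQ]; rfl) hP₀ne
  have hW : W.baseChange ℚ = W := by
    ext <;> simp [WeierstrassCurve.baseChange]
  have hxyW : W.toAffine.Nonsingular x y := by rw [← hW]; exact hxy
  set ι := algebraMap ℚ (AlgebraicClosure ℚ) with hι
  have hns' : (W.baseChange (AlgebraicClosure ℚ)).toAffine.Nonsingular (ι x) (ι y) :=
    (WeierstrassCurve.Affine.equation_iff_nonsingular).mp
      (WeierstrassCurve.Affine.Equation.map (algebraMap ℚ (AlgebraicClosure ℚ)) hxyW.left)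
  have hP₀eq : P₀ = Affine.Point.some _ _ hns' := by rw [← hQ]; rfl
  set P' : (W.baseChange (AlgebraicClosure ℚ)).toAffine.Point := Affine.Point.some (ι x) (ι y) hns' with hP'
  have h3P' : (3 : ℤ) • P' = 0 := by
    have h := h3P₀
    rw [hP₀eq] at h
    exact h
  have hP'ne : P' ≠ 0 := Affine.Point.some_ne_zero hns'
  -- `P₀` is not `2`-torsion, so `Ψ₃(x) = 0`
  have hyneg : ι y ≠ (W.baseChange (AlgebraicClosure ℚ)).toAffine.negY (ι x) (ι y) := by
    intro h
    have hneg : -P' = P' := by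
      rw [hP', Affine.Point.neg_some]
      simp only [Affine.Point.some.injEq, true_and]
      exact h.symm
    have h2 : P' + P' = 0 := by
      nth_rewrite 2 [← hneg]
      exact add_neg_cancel P'
    apply hP'ne
    have e : P' = (3 : ℤ) • P' - (P' + P') := by
      rw [show (3 : ℤ) • P' = P' + P' + P' by
        rw [show (3 : ℤ) = 1 + 1 + 1 by norm_num, add_zsmul, add_zsmul, one_zsmul]]
      abel
    rw [e, h3P', h2, sub_zero]
  have hΨ : W.Ψ₃.eval x = 0 := by
    have h := (WeierstrassCurve.three_smul_some_eq_zero_iff hns' hyneg).mp h3P'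
    rw [WeierstrassCurve.ψ_three, Polynomial.evalEval_C,
      show (W.baseChange (AlgebraicClosure ℚ)).Ψ₃ = W.Ψ₃.map ι from WeierstrassCurve.map_Ψ₃ W ι,
      Polynomial.eval_map, Polynomial.eval₂_hom] at h
    exact (algebraMap ℚ (AlgebraicClosure ℚ)).injective (by rw [h, map_zero])
  -- the `E♮`-avatar `T = (X₁, Y₁)` of `P₀`
  set X₁ : ℚ := x + W.b₂ / 12 with hX₁
  set Y₁ : ℚ := y + (W.a₁ * x + W.a₃) / 2 with hY₁
  have ex : X₁ - W.b₂ / 12 = x := by rw [hX₁]; ring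
  have ey : Y₁ - (W.a₁ * (X₁ - W.b₂ / 12) + W.a₃) / 2 = y := by rw [hY₁, hX₁]; ring
  have hsm : shortModel W 1 = (⟨0, 0, 0, -W.c₄ / 48, -W.c₆ / 864⟩ : WeierstrassCurve ℚ) := by
    ext <;> simp [shortModel] <;> ring
  haveI : (shortModel W 1).IsElliptic :=
    ⟨isUnit_iff_ne_zero.mpr (by rw [shortModel_Δ]; simpa using W.isUnit_Δ.ne_zero)⟩
  have hT : IsShortThreeTorsion W 1 X₁ Y₁ := by
    refine ⟨(WeierstrassCurve.Affine.equation_iff_nonsingular).mp (shortModel_equation_of_equation W hxyW.left), ?_⟩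
    show (shortModel W 1).Ψ₃.eval X₁ = 0
    rw [hsm, ← Ψ₃_eval_sub_b₂_div_twelve, ex]
    exact hΨ
  have hns'' : (W.baseChange (AlgebraicClosure ℚ)).toAffine.Nonsingular (ι (X₁ - W.b₂ / 12))
      (ι (Y₁ - (W.a₁ * (X₁ - W.b₂ / 12) + W.a₃) / 2)) := by rw [ey, ex]; exact hns'
  have hP₀' : P₀ = Affine.Point.some _ _ hns'' := by
    rw [hP₀eq]
    show (Affine.Point.some (ι x) (ι y) hns' : (W.baseChange (AlgebraicClosure ℚ)).toAffine.Point) =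
      Affine.Point.some _ _ hns''
    simp only [Affine.Point.some.injEq]
    exact ⟨by rw [ex], by rw [ey]⟩
  -- §1: the multiplier, and `k² = 9` from the covolume clause
  obtain ⟨k, hk0, -, -, h4, h6, hcovk⟩ :=
    exists_multiplier_of_isogeny_of_threeTorsion_mem_ker W D hT hP₀' φ hdeg hP₀ker hL₂
  have hpos : 0 < ZLattice.covolume D.L.lattice := ZLattice.covolume_pos D.L.lattice MeasureTheory.volume
  rw [hcov] at hcovk
  have hk9R : ‖((k : ℚ) : ℂ)‖ ^ 2 = 9 := by nlinarith
  have hk9 : k ^ 2 = 9 := by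
    rw [Complex.norm_ratCast, sq_abs] at hk9R
    exact_mod_cast hk9R
  have hk4 : k ^ 4 = (3 : ℚ) ^ 4 := by rw [show k ^ 4 = (k ^ 2) ^ 2 by ring, hk9]; norm_num
  have hk6 : k ^ 6 = (3 : ℚ) ^ 6 := by rw [show k ^ 6 = (k ^ 2) ^ 3 by ring, hk9]; norm_num
  rw [hk4] at h4
  rw [hk6] at h6
  exact hV W D hL h9 X₁ Y₁ hT ⟨W₂, ‹_›, ‹_›, h4, h6⟩

/-- **E-an-100₉ ⟺ NB₃^V**: an's Stevens-ledger row `NoConstantKernelAscendingThreeOptimalAtNine` (no ascending constant-kernel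
`3`-edge out of an `X₀(N)`-optimal curve at `9 ∣ N`, `Isogeny` language) and the lead's v14 stub `NoAscendingThreeTorsionOptimal`
(no rational `3`-torsion point whose Vélu `3`-quotient ascends, invariant language) are EQUIVALENT.
[cite: SilvermanAEC2009, III.4.12 and Thm. VI.4.1(b)] -/
theorem noConstantKernelAscendingAtNine_iff_noAscendingThreeTorsionOptimal :
    NoConstantKernelAscendingThreeOptimalAtNine ↔ NoAscendingThreeTorsionOptimal :=
  ⟨noAscendingThreeTorsionOptimal_of_noConstantKernelAscendingAtNine,
    noConstantKernelAscendingAtNine_of_noAscendingThreeTorsionOptimal⟩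

end Summit.BirchSwinnertonDyer.BirchSwinnertonDyer.Theorems.ManinLocalTwoThree

end
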